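import Mathlib
import Literature.NumberTheory.Transcendental.AssociatorsPentagonWeightFour
import HarnessLib

/-!
# Associators: the weight-two content of Drinfeld's pentagon equation

Companion of `AssociatorsPentagonWeightThree.lean` / `AssociatorsPentagonWeightFour.lean` one
weight DOWN: **for every solution `φ` of Drinfeld's pentagon (`NCSeries.DrinfeldPentagon`,
[Furusho2011, §2]) over a commutative ring with `c_∅ = 1` and `c_{X₀} = c_{X₁} = 0` one has
`4c_{X₀X₀} = 4c_{X₁X₁} = 0` and `2(c_{X₀X₁} + c_{X₁X₀}) = 0`** (`DrinfeldPentagon.weight_two_mul`);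
over a `ℚ`-algebra `c_{X₀X₀} = c_{X₁X₁} = 0`, `c_{X₁X₀} = -c_{X₀X₁}`
(`DrinfeldPentagon.apply_weight_two`) — the weight-`≤ 2` shape of a commutator-group-like series,
which `DrinfeldPentagon.apply_weight_four` ASSUMED, is automatic; `apply_weight_four'` drops those
hypotheses.  No group-likeness is used.  For `Φ_KZ` the content is `c_{yx} = +ζ(2) = -c_{xy}`: the
first genuinely REGULARISED coefficient is already pinned by the pentagon (used by the refuter of
crux `PentagonInKZ`, route KontsevichZagierPeriods/FurushoPentagon, to show that dropping the
shuffle regularisation breaks the pentagon in weight 2).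

## Method

As in weight three/four: a shifted representation `t_ij ↦ Q_ij ⊗ J₃` of
`U𝔞₄ ⊗ S/(deg > 2)` with `J₃` the `3 × 3` Jordan block.  The 4-dimensional permutation block is
blind to `c_{xy} + c_{yx}` in weight 2; the sign-twisted standard block `Sz` of the weight-four
file sees all three constraints: the `J₃²`-component of the pentagon identity read at the block
entries `(0,1)`, `(2,1)`, `(0,2)` gives `-4c_{xx} = 0`, `-4c_{yy} = 0`, `-2(c_{xy}+c_{yx}) = 0`
(51 integer matrix entries, `decide`d).

## References

* H. Furusho, *Double shuffle relation for associators*, Ann. of Math. 174 (2011), §2.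
  [Furusho2011]
* V. G. Drinfel'd, *On quasitriangular quasi-Hopf algebras …*, Leningrad Math. J. 2 (1991), §5
  (associators in low degree). [Drinfeld1991]
* D. Bar-Natan, *On associators and the Grothendieck–Teichmuller group I*, Selecta Math. 4 (1998).
  [BarNatan1998]
-/

noncomputable section

open Matrix
open scoped BigOperators Kronecker

namespace Literature.NumberTheory.Transcendental

universe u

namespace NCSeries

namespace PermRep

/-- The `3 × 3` nilpotent Jordan block. [folklore] -/
def J3z : Matrix (Fin 3) (Fin 3) ℤ := Matrix.of fun a b => if a.val + 1 = b.val then 1 else 0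

/-- `J₃³ = 0`, `(J₃²)₀₂ = 1`. [folklore] -/
theorem J3z_facts : J3z ^ 3 = 0 ∧ (J3z * J3z) 0 2 = 1 := by decide

variable {S : Type u} [CommRing S]

variable (S) in
/-- The Jordan block `J₃` over `S`. [folklore] -/
abbrev J3 : Matrix (Fin 3) (Fin 3) S := F S (Fin 3) J3z

/-- `J₃ (J₃ J₃) = 0`. [folklore] -/
theorem J3_mul3 : J3 S * (J3 S * J3 S) = 0 := by
  rw [← mul_assoc, J3, ← map_mul, ← map_mul, show J3z * J3z * J3z = J3z ^ 3 by rw [pow_succ, pow_two],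
    J3z_facts.1, map_zero]

/-- `(J₃ J₃)(J₃ J₃) = 0`. [folklore] -/
theorem J3_mul22 : J3 S * J3 S * (J3 S * J3 S) = 0 := by
  rw [mul_assoc, J3_mul3, mul_zero]

/-- `(J₃²)₀₂ = 1` over `S`. [folklore] -/
theorem J3_sq_apply : (J3 S * J3 S) 0 2 = 1 := by
  rw [J3, ← map_mul, RingHom.mapMatrix_apply, Matrix.map_apply, J3z_facts.2, map_one]

variable (S) in
/-- The representation on generators in truncation `2`: `t_ij ↦ Sz_ij ⊗ J₃`. [folklore] -/
def vS2 (p : Fin 4 × Fin 4) : Matrix (Fin 3 × Fin 3) (Fin 3 × Fin 3) S := F S (Fin 3) (Sz p) ⊗ₖ J3 S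

/-- **The sign-twisted standard representation of `U𝔞₄ ⊗ S/(deg > 2)`**, `t_ij ↦ Sz_ij ⊗ J₃`.
[folklore] -/
theorem exists_W2 : ∃ W : DrinfeldKohnoTrunc S (Fin 4) 2 →ₐ[S] Matrix (Fin 3 × Fin 3) (Fin 3 × Fin 3) S,
    ∀ i j, W (DrinfeldKohnoTrunc.t S 2 i j) = vS2 S (i, j) := by
  classical
  refine ⟨RingQuot.liftAlgHom S ⟨FreeAlgebra.lift S (vS2 S), fun a b hab => ?_⟩, fun i j => ?_⟩
  · cases hab with
    | diag i => simp [vS2, Sz_diag]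
    | symm i j => simp [vS2, Sz_symm i j]
    | fourTerm i j k hij hjk hik =>
      simp only [map_mul, map_add, FreeAlgebra.lift_ι_apply, vS2]
      simp only [← Matrix.add_kronecker, ← Matrix.mul_kronecker_mul, ← map_add (F S (Fin 3)),
        ← map_mul (F S (Fin 3)), Sz_fourTerm i j k hij hjk hik]
    | locality i j k l hij hik hil hjk hjl hkl =>
      simp only [map_mul, FreeAlgebra.lift_ι_apply, vS2]
      simp only [← Matrix.mul_kronecker_mul, ← map_mul (F S (Fin 3)),
        Sz_locality i j k l hij hik hil hjk hjl hkl]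
    | trunc g =>
      rw [map_list_prod, map_zero, List.map_ofFn]
      simp only [Function.comp_def, FreeAlgebra.lift_ι_apply, vS2, List.ofFn_succ, List.ofFn_zero,
        List.prod_cons, List.prod_nil, mul_one, ← Matrix.mul_kronecker_mul]
      rw [J3_mul3, Matrix.kronecker_zero]
  · exact (RingQuot.liftAlgHom_mkAlgHom_apply S (FreeAlgebra.lift S (vS2 S)) _ _).trans
      (FreeAlgebra.lift_ι_apply _ _)

/-- **`J₃`-graded form of a pentagon factor in weight `≤ 2`**: `φ(A ⊗ J₃, B ⊗ J₃) = 1 + X₂ ⊗ J₃²`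
with `X₂ = c_{xx} A² + c_{xy} AB + c_{yx} BA + c_{yy} B²`. [folklore] -/
theorem factor2_eq {m : Type} [Fintype m] [DecidableEq m] {φ : NCSeries Bool S} (h0 : φ [] = 1)
    (hx : φ [false] = 0) (hy : φ [true] = 0) (A B : Matrix m m S) :
    evalTrunc 2 (bsub (A ⊗ₖ J3 S) (B ⊗ₖ J3 S)) φ =
      1 + (φ [false, false] • (A * A) + φ [false, true] • (A * B) + φ [true, false] • (B * A) +
        φ [true, true] • (B * B)) ⊗ₖ (J3 S * J3 S) := by
  rw [evalTrunc_two_eq, h0, one_smul]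
  simp only [Fintype.sum_bool, hx, hy, zero_smul, add_zero, bsub_false, bsub_true,
    ← Matrix.mul_kronecker_mul, Matrix.add_kronecker, Matrix.smul_kronecker]
  abel

end PermRep

/-! ## The weight-two content of the pentagon -/

variable {S : Type u} [CommRing S]

open PermRep in
/-- **Weight two of Drinfeld's pentagon.** For every solution `φ` of the pentagon over a
commutative ring with `c_∅ = 1`, `c_{X₀} = c_{X₁} = 0`:
`4 c_{xx} = 0`, `4 c_{yy} = 0` and `2 (c_{xy} + c_{yx}) = 0`. [cite: Furusho2011, §2] -/
theorem DrinfeldPentagon.weight_two_mul {φ : NCSeries Bool S} (h : DrinfeldPentagon φ)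
    (h0 : φ [] = 1) (hx : φ [false] = 0) (hy : φ [true] = 0) :
    4 * φ [false, false] = 0 ∧ 4 * φ [true, true] = 0 ∧
      2 * (φ [false, true] + φ [true, false]) = 0 := by
  obtain ⟨W, hW⟩ := exists_W2 (S := S)
  have hsub : ∀ a b : DrinfeldKohnoTrunc S (Fin 4) 2,
      W (subst₂ 2 φ a b) = evalTrunc 2 (bsub (W a) (W b)) φ := by
    intro a b
    rw [subst₂, algHom_evalTrunc]
    congr 1
    funext c; cases c <;> rfl
  have hp := congrArg W (h 2)
  simp only [map_mul, hsub, map_add, t₄, hW, vS2] at hp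
  simp only [← Matrix.add_kronecker, ← map_add (F S (Fin 3))] at hp
  simp only [factor2_eq h0 hx hy] at hp
  simp only [mul_add, add_mul, one_mul, mul_one, ← Matrix.mul_kronecker_mul, J3_mul22,
    Matrix.kronecker_zero, add_zero] at hp
  have e01_1_ff : (Sz (0, 1) * Sz (0, 1)) 0 1 = 2 := by decide
  have e01_1_ft : (Sz (0, 1) * (Sz (1, 2) + Sz (1, 3))) 0 1 = 1 := by decide
  have e01_1_tf : ((Sz (1, 2) + Sz (1, 3)) * Sz (0, 1)) 0 1 = 4 := by decide
  have e01_1_tt : ((Sz (1, 2) + Sz (1, 3)) * (Sz (1, 2) + Sz (1, 3))) 0 1 = 0 := by decide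
  have e01_2_ff : ((Sz (0, 2) + Sz (1, 2)) * (Sz (0, 2) + Sz (1, 2))) 0 1 = -4 := by decide
  have e01_2_ft : ((Sz (0, 2) + Sz (1, 2)) * Sz (2, 3)) 0 1 = -1 := by decide
  have e01_2_tf : (Sz (2, 3) * (Sz (0, 2) + Sz (1, 2))) 0 1 = -2 := by decide
  have e01_2_tt : (Sz (2, 3) * Sz (2, 3)) 0 1 = 0 := by decide
  have e01_3_ff : (Sz (1, 2) * Sz (1, 2)) 0 1 = 0 := by decide
  have e01_3_ft : (Sz (1, 2) * Sz (2, 3)) 0 1 = 0 := by decide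
  have e01_3_tf : (Sz (2, 3) * Sz (1, 2)) 0 1 = 0 := by decide
  have e01_4_ff : ((Sz (0, 1) + Sz (0, 2)) * (Sz (0, 1) + Sz (0, 2))) 0 1 = 0 := by decide
  have e01_4_ft : ((Sz (0, 1) + Sz (0, 2)) * (Sz (1, 3) + Sz (2, 3))) 0 1 = 0 := by decide
  have e01_4_tf : ((Sz (1, 3) + Sz (2, 3)) * (Sz (0, 1) + Sz (0, 2))) 0 1 = 0 := by decide
  have e01_4_tt : ((Sz (1, 3) + Sz (2, 3)) * (Sz (1, 3) + Sz (2, 3))) 0 1 = 0 := by decide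
  have e01_5_ft : (Sz (0, 1) * Sz (1, 2)) 0 1 = 0 := by decide
  have e01_5_tf : (Sz (1, 2) * Sz (0, 1)) 0 1 = 2 := by decide
  have e21_1_ff : (Sz (0, 1) * Sz (0, 1)) 2 1 = 0 := by decide
  have e21_1_ft : (Sz (0, 1) * (Sz (1, 2) + Sz (1, 3))) 2 1 = -2 := by decide
  have e21_1_tf : ((Sz (1, 2) + Sz (1, 3)) * Sz (0, 1)) 2 1 = -1 := by decide
  have e21_1_tt : ((Sz (1, 2) + Sz (1, 3)) * (Sz (1, 2) + Sz (1, 3))) 2 1 = -4 := by decide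
  have e21_2_ff : ((Sz (0, 2) + Sz (1, 2)) * (Sz (0, 2) + Sz (1, 2))) 2 1 = 0 := by decide
  have e21_2_ft : ((Sz (0, 2) + Sz (1, 2)) * Sz (2, 3)) 2 1 = 4 := by decide
  have e21_2_tf : (Sz (2, 3) * (Sz (0, 2) + Sz (1, 2))) 2 1 = 1 := by decide
  have e21_2_tt : (Sz (2, 3) * Sz (2, 3)) 2 1 = 2 := by decide
  have e21_3_ff : (Sz (1, 2) * Sz (1, 2)) 2 1 = 0 := by decide
  have e21_3_ft : (Sz (1, 2) * Sz (2, 3)) 2 1 = 2 := by decide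
  have e21_3_tf : (Sz (2, 3) * Sz (1, 2)) 2 1 = 0 := by decide
  have e21_4_ff : ((Sz (0, 1) + Sz (0, 2)) * (Sz (0, 1) + Sz (0, 2))) 2 1 = 0 := by decide
  have e21_4_ft : ((Sz (0, 1) + Sz (0, 2)) * (Sz (1, 3) + Sz (2, 3))) 2 1 = 0 := by decide
  have e21_4_tf : ((Sz (1, 3) + Sz (2, 3)) * (Sz (0, 1) + Sz (0, 2))) 2 1 = 0 := by decide
  have e21_4_tt : ((Sz (1, 3) + Sz (2, 3)) * (Sz (1, 3) + Sz (2, 3))) 2 1 = 0 := by decide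
  have e21_5_ft : (Sz (0, 1) * Sz (1, 2)) 2 1 = 0 := by decide
  have e21_5_tf : (Sz (1, 2) * Sz (0, 1)) 2 1 = 0 := by decide
  have e02_1_ff : (Sz (0, 1) * Sz (0, 1)) 0 2 = 0 := by decide
  have e02_1_ft : (Sz (0, 1) * (Sz (1, 2) + Sz (1, 3))) 0 2 = 0 := by decide
  have e02_1_tf : ((Sz (1, 2) + Sz (1, 3)) * Sz (0, 1)) 0 2 = 0 := by decide
  have e02_1_tt : ((Sz (1, 2) + Sz (1, 3)) * (Sz (1, 2) + Sz (1, 3))) 0 2 = 0 := by decide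
  have e02_2_ff : ((Sz (0, 2) + Sz (1, 2)) * (Sz (0, 2) + Sz (1, 2))) 0 2 = 5 := by decide
  have e02_2_ft : ((Sz (0, 2) + Sz (1, 2)) * Sz (2, 3)) 0 2 = 0 := by decide
  have e02_2_tf : (Sz (2, 3) * (Sz (0, 2) + Sz (1, 2))) 0 2 = 2 := by decide
  have e02_2_tt : (Sz (2, 3) * Sz (2, 3)) 0 2 = 0 := by decide
  have e02_3_ff : (Sz (1, 2) * Sz (1, 2)) 0 2 = 0 := by decide
  have e02_3_ft : (Sz (1, 2) * Sz (2, 3)) 0 2 = 0 := by decide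
  have e02_3_tf : (Sz (2, 3) * Sz (1, 2)) 0 2 = 0 := by decide
  have e02_4_ff : ((Sz (0, 1) + Sz (0, 2)) * (Sz (0, 1) + Sz (0, 2))) 0 2 = 5 := by decide
  have e02_4_ft : ((Sz (0, 1) + Sz (0, 2)) * (Sz (1, 3) + Sz (2, 3))) 0 2 = 1 := by decide
  have e02_4_tf : ((Sz (1, 3) + Sz (2, 3)) * (Sz (0, 1) + Sz (0, 2))) 0 2 = 4 := by decide
  have e02_4_tt : ((Sz (1, 3) + Sz (2, 3)) * (Sz (1, 3) + Sz (2, 3))) 0 2 = 0 := by decide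
  have e02_5_ft : (Sz (0, 1) * Sz (1, 2)) 0 2 = 1 := by decide
  have e02_5_tf : (Sz (1, 2) * Sz (0, 1)) 0 2 = 0 := by decide

  have hne01 : ((0 : Fin 3), (0 : Fin 3)) ≠ ((1 : Fin 3), (2 : Fin 3)) := by decide
  have hne21 : ((2 : Fin 3), (0 : Fin 3)) ≠ ((1 : Fin 3), (2 : Fin 3)) := by decide
  have hne02 : ((0 : Fin 3), (0 : Fin 3)) ≠ ((2 : Fin 3), (2 : Fin 3)) := by decide
  have he01 := congrArg (fun M : Matrix (Fin 3 × Fin 3) (Fin 3 × Fin 3) S =>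
    M ((0 : Fin 3), (0 : Fin 3)) ((1 : Fin 3), (2 : Fin 3))) hp
  have he21 := congrArg (fun M : Matrix (Fin 3 × Fin 3) (Fin 3 × Fin 3) S =>
    M ((2 : Fin 3), (0 : Fin 3)) ((1 : Fin 3), (2 : Fin 3))) hp
  have he02 := congrArg (fun M : Matrix (Fin 3 × Fin 3) (Fin 3 × Fin 3) S =>
    M ((0 : Fin 3), (0 : Fin 3)) ((2 : Fin 3), (2 : Fin 3))) hp
  simp only [Matrix.add_apply, Matrix.kroneckerMap_apply, Matrix.one_apply_ne hne01,
    Matrix.one_apply_ne hne21, Matrix.one_apply_ne hne02, zero_add,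
    Matrix.smul_apply, smul_eq_mul, ← map_mul (F S (Fin 3))] at he01 he21 he02
  simp only [RingHom.mapMatrix_apply, Matrix.map_apply, J3z_facts.2,
    e01_1_ff, e01_1_ft, e01_1_tf, e01_1_tt, e01_2_ff, e01_2_ft, e01_2_tf, e01_2_tt, e01_3_ff,
    e01_3_ft, e01_3_tf, e01_4_ff, e01_4_ft, e01_4_tf, e01_4_tt, e01_5_ft, e01_5_tf, e21_1_ff,
    e21_1_ft, e21_1_tf, e21_1_tt, e21_2_ff, e21_2_ft, e21_2_tf, e21_2_tt, e21_3_ff, e21_3_ft,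
    e21_3_tf, e21_4_ff, e21_4_ft, e21_4_tf, e21_4_tt, e21_5_ft, e21_5_tf, e02_1_ff, e02_1_ft,
    e02_1_tf, e02_1_tt, e02_2_ff, e02_2_ft, e02_2_tf, e02_2_tt, e02_3_ff, e02_3_ft, e02_3_tf,
    e02_4_ff, e02_4_ft, e02_4_tf, e02_4_tt, e02_5_ft, e02_5_tf,
    map_zero, map_one, map_neg, map_ofNat, mul_zero, mul_one, add_zero, zero_add] at he01 he21 he02
  refine ⟨?_, ?_, ?_⟩
  · linear_combination -he01
  · linear_combination -he21
  · linear_combination -he02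

/-- **Weight two over a `ℚ`-algebra**: `c_{xx} = c_{yy} = 0` and `c_{yx} = -c_{xy}` — the
weight-`≤ 2` shape assumed in `DrinfeldPentagon.apply_weight_four` is automatic. [folklore] -/
theorem DrinfeldPentagon.apply_weight_two [Algebra ℚ S] {φ : NCSeries Bool S}
    (h : DrinfeldPentagon φ) (h0 : φ [] = 1) (hx : φ [false] = 0) (hy : φ [true] = 0) :
    φ [false, false] = 0 ∧ φ [true, true] = 0 ∧ φ [true, false] = -φ [false, true] := by
  obtain ⟨h1, h2, h3⟩ := h.weight_two_mul h0 hx hy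
  have u4 := isUnit_natCast_of_ne_zero (S := S) (n := 4) (by norm_num)
  have u2 := isUnit_natCast_of_ne_zero (S := S) (n := 2) (by norm_num)
  rw [Nat.cast_ofNat] at u4 u2
  refine ⟨u4.mul_right_eq_zero.mp h1, u4.mul_right_eq_zero.mp h2, ?_⟩
  exact eq_neg_of_add_eq_zero_right (u2.mul_right_eq_zero.mp h3)

/-- **Weight four of the pentagon without the weight-two hypotheses.** [folklore] -/
theorem DrinfeldPentagon.apply_weight_four' [Algebra ℚ S] {φ : NCSeries Bool S}
    (h : DrinfeldPentagon φ) (h0 : φ [] = 1) (hx : φ [false] = 0) (hy : φ [true] = 0) :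
    5 * φ [false, false, false, true] + 2 * (φ [false, true] * φ [false, true]) = 0 ∧
    10 * φ [false, false, true, true] - φ [false, true] * φ [false, true] = 0 ∧
    10 * φ [false, true, false, true] - 3 * (φ [false, true] * φ [false, true]) = 0 ∧
    5 * φ [false, true, true, true] + 2 * (φ [false, true] * φ [false, true]) = 0 := by
  obtain ⟨hxx, hyy, hyx⟩ := h.apply_weight_two h0 hx hy
  exact h.apply_weight_four h0 hx hy hxx hyy hyx

end NCSeries

end Literature.NumberTheory.Transcendental

end
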